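import Mathlib.Data.Matrix.Basic
import Mathlib.Data.Finsupp.Defs
import HarnessLib

/-!
# A kernel-decidable BULK checker kit for the fan-side binders of `CICertificates.ciCertificates` /
# `PointFixableOfCert.pointFixable_of_ciCert` (crux `FInjectiveMacaulayfication`, road B, pool item U12)

[OURS · L1 W4.5a] Support file for crux stmt-ResolutionOfSingularities-15315 (res-L1-w45a-plan-1 R12.33 (c), seat res-L1-w45a-stub-4).
The road-B instance of the deciding specimen `T⁽⁴⁾` at `p = 7` has `t = 537` unimodular charts on `88` rays and a monomial centre
with `|A| = 1926` generators in `n = 5` variables (res-L1-w45a-tri-1, `cert-T4-own-p7.v1.1.json`); the fan-side hypotheses of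
`pointFixable_of_ciCert` — `hm`, `haA`, (hgen), (hge) (`537 × 1926` vector inequalities), the cover records (hcov), unimodularity
`hV`, (hunit), `hprim`, `hAJ` — are ≈ 10⁶ small arithmetic facts: too many for `fin_cases c <;> decide`, cheap for ONE structural
pass over the data. MEASURED KERNEL FACTS that shape this file (T⁽⁴⁾ data, farm `lean check`): kernel `decide` re-reduces a
looked-up term at EVERY use (no sharing) and pays `O(i)` for the `i`-th list element and ≈ 10² steps for a `![…]` access; a `5`-term
dot product in `Fin n → ℕ`/`Matrix` currency costs ≈ 1 ms. Hence the currency here (the pattern of stub-6's `KLocCellKit`,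
computable list programs):

* THE DATA FORMAT (§1). Vectors are `List ℕ` of length `n`. `AL2 : List (List (List ℕ))` = the generators, TWO-LEVEL (chunks of
  ≈ √|A| vectors; a generator is addressed by an index PAIR `(chunk, position)`, so a lookup costs ≈ 2√|A| steps, not `|A|/2`);
  `RAYS : List (List ℕ)` = the rays; ONE per-chart record list `CL : List (List ℕ × (ℕ × ℕ) × List (ℕ × ℕ) × List (List ℕ))` =
  (ray INDICES of the rows of `V c`, index pair of the vertex `m c`, index pairs of the neighbours `a c i`, the `r` exceptional
  vectors `d c l`) in chart order; `VinvTL : List (List (List ℤ))` = per chart the COLUMNS of an integer inverse of `V c`;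
  `NuL : List (List ℕ)` = the (hunit) multipliers; `RL : List (ℕ × ℕ × (ℕ × ℕ) × List ℕ)` = cover records `(c, K, index pair of b, r)`
  aligned with `AL2.flatten`; `PJ : List (ℕ × ℕ)` = index pairs of the pure powers. (`hm`, `haA`, `b ∈ A` are then index bounds.)
  Lists are plain literals (one `set_option maxRecDepth` for the long ones).
* THE ACCESSORS (§1) turning the lists into the binder objects of `pointFixable_of_ciCert`: `getL` (structural `List.getD`), `get2`,
  `vecOf`, `expOf` (`symm ∘ vecOf`, `symm = Finsupp.equivFunOnFinite.symm`), `genSet n AL2 = (AL2.flatten.map expOf).toFinset` (the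
  `A`; = stub-5's `(AL.map symm).toFinset` for `AL = AL2.flatten` read through `vecOf`), `chartV n RAYS CL t`, `chartM n AL2 CL t`,
  `chartA n AL2 CL t`, `chartD n r CL t`.
* LIST PRIMITIVES (§2) by simultaneous structural recursion (no indexing in loops, no `Finset`/`Fintype` decidability, `Nat.beq/ble/blt`):
  `veqL`, `vleL`, `dotL`, `dotZL`, `addL`, `smulL`, `addUnitL`, `mulVecL`, `raysOf`, `minDotL`, `minDotL2`, `maxDotRows`, `colL`, `sumScaledL`,
  `allLen`, `inRange2`,
  and the FORCING combinators `forceL`, `forceLL` (`forceL l k = k l`, but the kernel evaluates `l` once and hands `k` the literal —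
  used exactly where a looked-up vector is consumed more than once).
* THE BULK BOOLEAN CHECKS (§3): `checkShapes` (lengths and index bounds — the only hypothesis of `hm`/`haA`), `checkHgen`,
  `checkHge` (ONE pass over the rays: `max_{rows (c,i) on ray v} ⟨v, m_c⟩ ≤ min_{e ∈ A} ⟨v, e⟩` — `88 × (1926 + 537)` dot products instead
  of `537 × 5 × 1926`), `checkHcov`, `checkDetUnit` (`V · Vinv = 1` over `ℤ`), `checkHunit`, `checkHprim`, `checkHAJ`.

SOUNDNESS (`FanCheckSound*`: `checkX … = true` — ONE `decide +kernel` each — gives the corresponding binder VERBATIM at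
`A := genSet n AL2`, `V := chartV n RAYS CL t`, `m := chartM n AL2 CL t`, `a := chartA n AL2 CL t`, `d := chartD n r CL t`) is in the
companion files. Definitions only (computable except the `Finsupp`-valued accessors; no instances, no notation); AI-written, weaker
than expert review; no statement of [claim: Hironaka2017] is used. [folklore]
-/

-- single-problem summit: the doubled namespace component is forced
set_option linter.dupNamespace false

namespace Summit.ResolutionOfSingularities.ResolutionOfSingularities.Theorems.FInjectiveMacaulayfication.FanCheckKit

/-! ## §1 Data format and accessors -/

/-- Structural `List.getD`: the `i`-th element or the default. [folklore] -/
def getL {α : Type} : List α → ℕ → α → α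
  | [], _, d => d
  | a :: _, 0, _ => a
  | _ :: as, i + 1, d => getL as i d

/-- Two-level access: the generator with index pair `ip = (chunk, position)`. [folklore] -/
def get2 (AL2 : List (List (List ℕ))) (ip : ℕ × ℕ) : List ℕ := getL (getL AL2 ip.1 []) ip.2 []

/-- A `List ℕ` read as an exponent vector `Fin n → ℕ` (entries past the end are `0`). [folklore] -/
def vecOf (n : ℕ) (l : List ℕ) : Fin n → ℕ := fun i => getL l i.1 0

/-- A `List ℤ` read as an integer vector `Fin n → ℤ`. [folklore] -/
def vecOfZ (n : ℕ) (l : List ℤ) : Fin n → ℤ := fun i => getL l i.1 0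

/-- A `List ℕ` read as an exponent `Fin n →₀ ℕ`. [folklore] -/
noncomputable def expOf (n : ℕ) (l : List ℕ) : Fin n →₀ ℕ := Finsupp.equivFunOnFinite.symm (vecOf n l)

/-- The monomial generator set `A ⊂ ℕⁿ` of the centre: `(AL2.flatten.map expOf).toFinset`. [folklore] -/
noncomputable def genSet (n : ℕ) (AL2 : List (List (List ℕ))) : Finset (Fin n →₀ ℕ) := (AL2.flatten.map (expOf n)).toFinset

/-- The `c`-th chart record `(ray indices of V c, index of m c, indices of a c ·, vectors d c ·)` (default past the end). [folklore] -/
def chartRec (CL : List (List ℕ × (ℕ × ℕ) × List (ℕ × ℕ) × List (List ℕ))) (c : ℕ) :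
    List ℕ × (ℕ × ℕ) × List (ℕ × ℕ) × List (List ℕ) :=
  getL CL c ([], (0, 0), [], [])

/-- The matrix whose `i`-th row is the ray with index `idx[i]`. [folklore] -/
def rayMat (n : ℕ) (RAYS : List (List ℕ)) (idx : List ℕ) : Matrix (Fin n) (Fin n) ℕ :=
  Matrix.of fun i j => vecOf n (getL RAYS (getL idx i.1 0) []) j

/-- The unimodular cone matrices `V : Fin t → Matrix (Fin n) (Fin n) ℕ` (rows = primitive rays). [folklore] -/
def chartV (n : ℕ) (RAYS : List (List ℕ)) (CL : List (List ℕ × (ℕ × ℕ) × List (ℕ × ℕ) × List (List ℕ))) (t : ℕ) :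
    Fin t → Matrix (Fin n) (Fin n) ℕ :=
  fun c => rayMat n RAYS (chartRec CL c.1).1

/-- The vertices `m : Fin t → (Fin n →₀ ℕ)`. [folklore] -/
noncomputable def chartM (n : ℕ) (AL2 : List (List (List ℕ))) (CL : List (List ℕ × (ℕ × ℕ) × List (ℕ × ℕ) × List (List ℕ))) (t : ℕ) :
    Fin t → (Fin n →₀ ℕ) :=
  fun c => expOf n (get2 AL2 (chartRec CL c.1).2.1)

/-- The neighbours `a : Fin t → Fin n → (Fin n →₀ ℕ)` (`a c i = m c + u_{c,i}`). [folklore] -/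
noncomputable def chartA (n : ℕ) (AL2 : List (List (List ℕ))) (CL : List (List ℕ × (ℕ × ℕ) × List (ℕ × ℕ) × List (List ℕ))) (t : ℕ) :
    Fin t → Fin n → (Fin n →₀ ℕ) :=
  fun c i => expOf n (get2 AL2 (getL (chartRec CL c.1).2.2.1 i.1 (0, 0)))

/-- The exceptional multiplicities `d : Fin t → Fin r → (Fin n →₀ ℕ)` (`θ_c (Fs l) = Y^(d c l) · gs c l`). [folklore] -/
noncomputable def chartD (n r : ℕ) (CL : List (List ℕ × (ℕ × ℕ) × List (ℕ × ℕ) × List (List ℕ))) (t : ℕ) :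
    Fin t → Fin r → (Fin n →₀ ℕ) :=
  fun c l => expOf n (getL (chartRec CL c.1).2.2.2 l.1 [])

/-! ## §2 List primitives (simultaneous structural recursion; no indexing inside loops) -/

/-- FORCE a vector: `forceL l k = k l`, evaluated by first reducing `l` to a literal (so `k` may use it many times at no cost).
[folklore] -/
def forceL : List ℕ → (List ℕ → Bool) → Bool
  | [], k => k []
  | a :: as, k => forceL as fun tl => k (a :: tl)

/-- FORCE a list of vectors (spine and entries): `forceLL L k = k L`. [folklore] -/
def forceLL : List (List ℕ) → (List (List ℕ) → Bool) → Bool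
  | [], k => k []
  | v :: vs, k => forceL v fun v' => forceLL vs fun tl => k (v' :: tl)

/-- Boolean equality of two `List ℕ` of equal length (`false` on a length mismatch). [folklore] -/
def veqL : List ℕ → List ℕ → Bool
  | [], [] => true
  | a :: as, b :: bs => Nat.beq a b && veqL as bs
  | _, _ => false

/-- Boolean componentwise `≤` of two `List ℕ` of equal length (`false` on a length mismatch). [folklore] -/
def vleL : List ℕ → List ℕ → Bool
  | [], [] => true
  | a :: as, b :: bs => Nat.ble a b && vleL as bs
  | _, _ => false

/-- The dot product of two `List ℕ` (truncating to the shorter). [folklore] -/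
def dotL : List ℕ → List ℕ → ℕ
  | a :: as, b :: bs => a * b + dotL as bs
  | _, _ => 0

/-- The dot product of a `List ℕ` with a `List ℤ` (truncating to the shorter). [folklore] -/
def dotZL : List ℕ → List ℤ → ℤ
  | a :: as, b :: bs => (a : ℤ) * b + dotZL as bs
  | _, _ => 0

/-- Componentwise sum (truncating to the shorter). [folklore] -/
def addL : List ℕ → List ℕ → List ℕ
  | a :: as, b :: bs => (a + b) :: addL as bs
  | _, _ => []

/-- Scalar multiple. [folklore] -/
def smulL (K : ℕ) (l : List ℕ) : List ℕ := l.map fun x => K * x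

/-- Add `1` at position `i` (`w + e_i`; unchanged if `i` is past the end). [folklore] -/
def addUnitL : List ℕ → ℕ → List ℕ
  | [], _ => []
  | a :: as, 0 => (a + 1) :: as
  | a :: as, i + 1 => a :: addUnitL as i

/-- Matrix (as a list of rows) times vector. [folklore] -/
def mulVecL (rows : List (List ℕ)) (v : List ℕ) : List ℕ := rows.map fun row => dotL row v

/-- The rows of a chart: the rays with the given indices. [folklore] -/
def raysOf (RAYS : List (List ℕ)) (idx : List ℕ) : List (List ℕ) := idx.map fun j => getL RAYS j []

/-- `min_{e ∈ L} ⟨v, e⟩` (`0` on the empty list). [folklore] -/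
def minDotL (v : List ℕ) : List (List ℕ) → ℕ
  | [] => 0
  | [e] => dotL v e
  | e :: es => min (dotL v e) (minDotL v es)

/-- `min_{e ∈ AL2} ⟨v, e⟩` over a two-level list (`0` on the empty list). [folklore] -/
def minDotL2 (v : List ℕ) : List (List (List ℕ)) → ℕ
  | [] => 0
  | [ch] => minDotL v ch
  | ch :: chs => min (minDotL v ch) (minDotL2 v chs)

/-- `max ⟨v, m_c⟩` over the charts `c` one of whose rows carries the ray index `j` (`0` if none). [folklore] -/
def maxDotRows (AL2 : List (List (List ℕ))) (CL : List (List ℕ × (ℕ × ℕ) × List (ℕ × ℕ) × List (List ℕ))) (v : List ℕ) (j : ℕ) : ℕ :=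
  CL.foldr (fun ch acc => bif ch.1.any (fun j' => Nat.beq j' j) then max (dotL v (get2 AL2 ch.2.1)) acc else acc) 0

/-- Column `j'` of a list of vectors. [folklore] -/
def colL (vs : List (List ℕ)) (j' : ℕ) : List ℕ := vs.map fun v => getL v j' 0

/-- `Σ_j d_j • vs_j` as a length-`n` vector: its component `j'` is `⟨d, column j' of vs⟩`. [folklore] -/
def sumScaledL (n : ℕ) (d : List ℕ) (vs : List (List ℕ)) : List ℕ := (List.range n).map fun j' => dotL d (colL vs j')

/-- All lists of the family have length `n`. [folklore] -/
def allLen (n : ℕ) (L : List (List ℕ)) : Bool := L.all fun l => Nat.beq l.length n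

/-- An index pair addresses an actual generator. [folklore] -/
def inRange2 (AL2 : List (List (List ℕ))) (ip : ℕ × ℕ) : Bool := Nat.blt ip.1 AL2.length && Nat.blt ip.2 (getL AL2 ip.1 []).length

/-! ## §3 The bulk Boolean checks -/

/-- (shapes) every vector has length `n`, every ray/generator index is in range, every chart has `n` rows, `n` neighbours and `r`
exceptional vectors. This alone yields `hm` and `haA`. [folklore] -/
def checkShapes (n r : ℕ) (AL2 : List (List (List ℕ))) (RAYS : List (List ℕ)) (CL : List (List ℕ × (ℕ × ℕ) × List (ℕ × ℕ) × List (List ℕ))) : Bool :=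
  (AL2.all fun ch => allLen n ch) && allLen n RAYS &&
    CL.all fun ch => Nat.beq ch.1.length n && (ch.1.all fun j => Nat.blt j RAYS.length) && inRange2 AL2 ch.2.1 &&
      Nat.beq ch.2.2.1.length n && (ch.2.2.1.all fun k => inRange2 AL2 k) && Nat.beq ch.2.2.2.length r && allLen n ch.2.2.2

/-- (hgen), one chart with forced rows and vertex: `V c · a c i = V c · m c + e_i` for every `i`. [folklore] -/
def hgenChart (n : ℕ) (AL2 : List (List (List ℕ))) (rows : List (List ℕ)) (m : List ℕ) (aidx : List (ℕ × ℕ)) : Bool :=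
  ((List.range n).zip aidx).all fun ik => veqL (mulVecL rows (get2 AL2 ik.2)) (addUnitL (mulVecL rows m) ik.1)

/-- (hgen) `V c · a c i = V c · m c + e_i` for all `c, i`. [folklore] -/
def checkHgen (n : ℕ) (AL2 : List (List (List ℕ))) (RAYS : List (List ℕ)) (CL : List (List ℕ × (ℕ × ℕ) × List (ℕ × ℕ) × List (List ℕ))) : Bool :=
  CL.all fun ch => forceLL (raysOf RAYS ch.1) fun rows => forceL (get2 AL2 ch.2.1) fun m => hgenChart n AL2 rows m ch.2.2.1

/-- (hge), the rays from index `j` on: `max_{rows on ray j} ⟨v_j, m_c⟩ ≤ min_{e ∈ A} ⟨v_j, e⟩`. [folklore] -/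
def checkHgeFrom (AL2 : List (List (List ℕ))) (CL : List (List ℕ × (ℕ × ℕ) × List (ℕ × ℕ) × List (List ℕ))) : ℕ → List (List ℕ) → Bool
  | _, [] => true
  | j, v :: vs => Nat.ble (maxDotRows AL2 CL v j) (minDotL2 v AL2) && checkHgeFrom AL2 CL (j + 1) vs

/-- (hge) `V c · m c ≤ V c · e` componentwise for all charts `c` and generators `e` — the vertex property, ray by ray. [folklore] -/
def checkHge (AL2 : List (List (List ℕ))) (RAYS : List (List ℕ)) (CL : List (List ℕ × (ℕ × ℕ) × List (ℕ × ℕ) × List (List ℕ))) : Bool :=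
  checkHgeFrom AL2 CL 0 RAYS

/-- (hcov) the cover records: record `(c, K, ib, r)` at the position of the generator `a` certifies `c < t`, `1 ≤ K`, `b = AL2[ib] ∈ A`
and `K • a = m c + (K − 1) • b + r`. [folklore] -/
def checkHcov (n : ℕ) (AL2 : List (List (List ℕ))) (CL : List (List ℕ × (ℕ × ℕ) × List (ℕ × ℕ) × List (List ℕ))) (t : ℕ)
    (RL : List (ℕ × ℕ × (ℕ × ℕ) × List ℕ)) : Bool :=
  Nat.beq AL2.flatten.length RL.length && (AL2.flatten.zip RL).all fun ar =>
    Nat.blt ar.2.1 t && Nat.ble 1 ar.2.2.1 && inRange2 AL2 ar.2.2.2.1 && Nat.beq ar.2.2.2.2.length n &&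
      veqL (smulL ar.2.2.1 ar.1)
        (addL (addL (get2 AL2 (chartRec CL ar.2.1).2.1) (smulL (ar.2.2.1 - 1) (get2 AL2 ar.2.2.2.1))) ar.2.2.2.2)

/-- (hV) unimodularity by integer inverse COLUMNS: `Σ_l (V c)_{i l} (W c)_{l j} = δ_{i j}`. [folklore] -/
def checkDetUnit (n : ℕ) (RAYS : List (List ℕ)) (CL : List (List ℕ × (ℕ × ℕ) × List (ℕ × ℕ) × List (List ℕ)))
    (VinvTL : List (List (List ℤ))) : Bool :=
  Nat.beq CL.length VinvTL.length && (CL.zip VinvTL).all fun cw =>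
    Nat.beq cw.2.length n && (cw.2.all fun col => Nat.beq col.length n) &&
      forceLL (raysOf RAYS cw.1.1) fun rows =>
        ((List.range n).zip rows).all fun irow => ((List.range n).zip cw.2).all fun jcol =>
          dotZL irow.2 jcol.2 == (bif Nat.beq irow.1 jcol.1 then (1 : ℤ) else 0)

/-- (hunit) `Σ_j (d c l)_j • a c j ≤ N_{c,l} • m c` componentwise, for the multiplier table `NuL`. [folklore] -/
def checkHunit (n r : ℕ) (AL2 : List (List (List ℕ))) (CL : List (List ℕ × (ℕ × ℕ) × List (ℕ × ℕ) × List (List ℕ))) (NuL : List (List ℕ)) : Bool :=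
  Nat.beq CL.length NuL.length && (CL.zip NuL).all fun cn =>
    Nat.beq cn.2.length r &&
      forceL (get2 AL2 cn.1.2.1) fun m => forceLL (cn.1.2.2.1.map fun k => get2 AL2 k) fun avecs =>
        (cn.1.2.2.2.zip cn.2).all fun dN => vleL (sumScaledL n dN.1 avecs) (smulL dN.2 m)

/-- (hprim) `AL[PJ[j]]` is a pure power of `X_j`, for every `j < n`. [folklore] -/
def checkHprim (n : ℕ) (AL2 : List (List (List ℕ))) (PJ : List (ℕ × ℕ)) : Bool :=
  Nat.beq PJ.length n && ((List.range n).zip PJ).all fun jk =>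
    inRange2 AL2 jk.2 && ((List.range n).zip (get2 AL2 jk.2)).all fun ix => Nat.beq ix.1 jk.1 || Nat.beq ix.2 0

/-- (hAJ) no generator is `0`. [folklore] -/
def checkHAJ (AL2 : List (List (List ℕ))) : Bool := AL2.all fun ch => ch.all fun a => a.any fun x => Nat.blt 0 x

end Summit.ResolutionOfSingularities.ResolutionOfSingularities.Theorems.FInjectiveMacaulayfication.FanCheckKit
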